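import Summits.QuantumFields.BalabanUV.T4Continuum.Support.NE7K1LinTorusResolventDict
import Summits.QuantumFields.BalabanUV.T4Continuum.Support.NE7K1LinTorusLineFourier
import Summits.QuantumFields.BalabanUV.T4Continuum.Support.NE7K1LinStripClassLineDecay

/-!
# NE7K1LinTorusResolventInverse — row NE7 (node U5), candidate route HOM, path H1L, cell K1-lin(s): NEEDS-ESTIMATE #E1, R-E1 TRANCHE E
# (operator-level torus docking), STEP 3b(i) — INVERTIBILITY OF THE TRANSPORTED LINE AND THE RESOLVENT APPLIED TO A BLOCK-CONSTANT
# COARSE PLANE WAVE: `(T^𝕋(s) + a·Q_n^*Q_n)⁻¹ (χ_p ∘ blk_n) = Φ^R_p` (file 74's explicit fibre field), for `a > 0`, `0 ≤ s ≤ 1`, centred `p`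

Lineage `b2b-balaban-t4-ne7-p2` (CRUX PROVER NE7 #2), generation 76; file 76.  File 74 proved `(torLineRepA)·Φ^R_p = χ_p ∘ blk_n`
(`line_resolvent_wave`); file 34 proved `IsUnit (torLine(n,a,s)).det` for `a > 0`, `0 ≤ s ≤ 1` (`isUnit_det_torLine`).  THIS FILE
([folklore] linear algebra): `torLineRepA` is a reindexing of `torLine(n,a,s)` (`torLineRepA_eq_reindex`), hence has unit determinant
(`isUnit_det_torLineRepA`), so does its complexification (`isUnit_det_torLineRepA_C`), and therefore
**`inv_mulVec_blockWave`**: `((torLineRepA).map ofReal)⁻¹ *ᵥ (χ_p ∘ blk_n) = Φ^R_p` — the resolvent of the two-cutoff line applied to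
`Q_n^*χ_p` IS the explicit field; with file 75's `resFieldR_finePt` its value at `n·x⁰ + τ` is `χ_p(x⁰)·GS n (lineSymb L n s) a τ (θ(p))`.
§2: the block indicator as a dual sum (`blockIndicator_eq_dualSum`, file 60's `sum_chiT_dual`), centred representatives `cRepZ`, and
**`resolventKernel_eq_dualSum`**: `Σ_{x′}(A_ℂ⁻¹)(x,x′)·1[blk_n x′ = β] = |𝕋̂_c|⁻¹Σ_{p} χ_{c(p)}(x⁰ − β)·GS n (lineSymb L n s) a τ (θ(c(p)))`
— the kernel of `(T^𝕋(s) + aQ_n^*Q_n)⁻¹Q_n^*` IS the discrete-torus Fourier sum of the strip multiplier at centred momenta.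

§3 **`resolventKernel_eq_torusKernelS`** — R-E1's OPERATOR-LEVEL TORUS DOCKING: the dual sum of §2 IS file 68's
`torusKernelS n (lineSymb L n s) a τ (dbl M) (x⁰ − β)` (re-index `boxDom (2M)` by the grid: file 61's `sum_boxDom_eq_sum_grid`, `card_boxDom`,
`rep_grid_eq`, `mFourier_gridPt_eq_chiT`; `cRepZ_grid`: the centring IS file 61's `cRep`).  Hence files 62–71's estimates on `torusKernelS` of
the line ARE estimates on `(T^𝕋(s) + aQ_n^*Q_n)⁻¹Q_n^*` for every `s ∈ [0,1]`.  REMAINING for R-E1 (successor, on demand): (2.37) and the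
boundary-condition layers (B4 Prop. 2.2's `G(Ω, Λ, A)`), and the card §3u bookkeeping.  §4 restates the docking on the original index
type `↥((boxDom (dbl (nLM))).image (blk L))` of files 33–41∕58–59 (`torLine_resolventKernel_eq_torusKernelS`, via `Matrix.inv_reindex`).

HONEST FRAMING: [folklore]; nothing of Bałaban's asserted; no `sorry`.  Census only; NE7 NOT PRINTED ∕ NOT PROVED; spine 0∕9; FIXED FINITE
T⁴, rung (B)+1; NOT infinite volume, NOT mass gap, NOT Clay.  HONEST DEPENDENCY: continuum YM on T⁴ ⇐ BetaPertH ∧ nine spine estimates (0/9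
proved); BetaPertH ⇐ (D1) ∧ (D4) ∧ CAP+tail; G-an2-4 gates asym, D1 and NE2/3/4.
-/

noncomputable section

open Finset Matrix Complex

namespace Summit.QuantumFields.BalabanUV.T4Continuum.NE7K1LinTorusResolventInverse

open Literature.MathematicalPhysics.QuantumFieldTheory.Balaban1983to89
open Literature.MathematicalPhysics.QuantumFieldTheory.Balaban1983to89.B4Reflection242
open Literature.MathematicalPhysics.QuantumFieldTheory.Balaban1983to89.B4Lower18
open NE7K1LinFoldKernels NE7K1LinFoldMatrices NE7K1LinSchurFoldBox NE7K1LinTorusLineInvariant NE7K1LinSchurLineU1 NE7K1LinTorusLineSymbol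
open Literature.MathematicalPhysics.QuantumFieldTheory.Balaban1983to89.B4Green244 (finePt)
open Literature.MathematicalPhysics.QuantumFieldTheory.Balaban1983to89.B4Strip (ofRealVec)
open Literature.MathematicalPhysics.QuantumFieldTheory.Balaban1983to89.B4TorusPositivity (wrap)
open NE7K1LinTorusFineWaves NE7K1LinTorusFineWavesFibre NE7K1LinTorusResolventFibre NE7K1LinTorusResolventLine
open Literature.MathematicalPhysics.QuantumFieldTheory.Balaban1983to89.B4TorusKernel (rep)
open Literature.MathematicalPhysics.QuantumFieldTheory.Balaban1983to89.B4TorusKernel.MultiPeriod (gridPt)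
open NE7K1LinTorusLineEngine NE7K1LinTorusLineFourier NE7K1LinTorusResolventDict NE7K1LinStripClassLine NE7K1LinStripClassSums
open NE7K1LinStripClassLineDecay

variable {d : ℕ}

section Inverse

variable {n L : ℕ} [NeZero n] [NeZero L] {M : Fin (d + 1) → ℕ}

/-- the identification of the `L`-block labels of the fine torus with the representatives `boxDom (dbl (n·M))` (file 33's
`image_fineTor`), as an equivalence of index types. [folklore] -/
def repEquiv (n L : ℕ) [NeZero L] (M : Fin (d + 1) → ℕ) :
    ↥((boxDom (dbl fun i => n * L * M i)).image (blk L)) ≃ ↥(boxDom (dbl fun i => n * M i)) :=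
  Equiv.subtypeEquivRight (fun x => by rw [image_fineTor (NeZero.one_le : 1 ≤ L) n M])

omit [NeZero n] in
/-- `torLineRepA` is the reindexing of `torLine(n, a, s)` along `repEquiv`. [folklore] -/
theorem torLineRepA_eq_reindex (hn : 1 ≤ n) (M : Fin (d + 1) → ℕ) (a s : ℝ) :
    torLineRepA (L := L) hn M a s = Matrix.reindex (repEquiv n L M) (repEquiv n L M)
      (torLine (isBlockUnion_fine (fineTor_isBlockUnion hn (NeZero.one_le : 1 ≤ L) M)) n a (fun i => n * L * M i)
        (fun i => n * M i) s) := by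
  ext x y
  rfl

omit [NeZero n] in
/-- **the transported line has unit determinant** (`a > 0`, `0 ≤ s ≤ 1`; file 34's `isUnit_det_torLine`). [folklore] -/
theorem isUnit_det_torLineRepA (hn : 1 ≤ n) (hM : ∀ i, 1 ≤ M i) {a : ℝ} (ha : 0 < a) {s : ℝ} (hs0 : 0 ≤ s) (hs1 : s ≤ 1) :
    IsUnit (torLineRepA (L := L) hn M a s).det := by
  rw [torLineRepA_eq_reindex, Matrix.det_reindex_self]
  exact isUnit_det_torLine hn ha hM hs0 hs1

omit [NeZero n] in
/-- the complexified transported line has unit determinant. [folklore] -/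
theorem isUnit_det_torLineRepA_C (hn : 1 ≤ n) (hM : ∀ i, 1 ≤ M i) {a : ℝ} (ha : 0 < a) {s : ℝ} (hs0 : 0 ≤ s) (hs1 : s ≤ 1) :
    IsUnit ((torLineRepA (L := L) hn M a s).map (Complex.ofReal)).det := by
  have h := isUnit_det_torLineRepA (L := L) hn hM ha hs0 hs1
  rw [isUnit_iff_ne_zero] at h ⊢
  have e : (torLineRepA (L := L) hn M a s).map (Complex.ofReal) = Complex.ofRealHom.mapMatrix (torLineRepA (L := L) hn M a s) := rfl
  rw [e, ← RingHom.map_det]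
  intro h0
  exact h (by exact_mod_cast (Complex.ofReal_eq_zero.mp h0))

omit [NeZero n] in
/-- the complexified line acting on a complex field is file 74's sum. [folklore] -/
theorem map_mulVec_apply (hn : 1 ≤ n) (M : Fin (d + 1) → ℕ) (a s : ℝ) (Φ : ↥(boxDom (dbl fun i => n * M i)) → ℂ)
    (x : ↥(boxDom (dbl fun i => n * M i))) :
    (((torLineRepA (L := L) hn M a s).map (Complex.ofReal)) *ᵥ Φ) x =
      ∑ x', (torLineRepA (L := L) hn M a s x x' : ℂ) * Φ x' := rfl

/-- **THE RESOLVENT OF THE TWO-CUTOFF LINE ON A BLOCK-CONSTANT COARSE PLANE WAVE**: for `a > 0`, `0 ≤ s ≤ 1`, every mesh `n ≥ 1`, torus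
`M` and centred coarse dual index `p` (`2|p_μ| ≤ 2M_μ`),
`((torLineRepA)ℂ)⁻¹ (χ_p ∘ blk_n) = Φ^R_p` — B4 (2.47) for the line as an identity about the INVERSE operator. [folklore] -/
theorem inv_mulVec_blockWave (hn : 1 ≤ n) (hM : ∀ i, 1 ≤ M i) {a : ℝ} (ha : 0 < a) {s : ℝ} (hs0 : 0 ≤ s) (hs1 : s ≤ 1)
    (y₀ : ↥(boxDom (dbl fun i => n * M i))) {p : Fin (d + 1) → ℤ} (hp : ∀ μ, 2 * |p μ| ≤ (dbl M μ : ℤ)) :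
    ((torLineRepA (L := L) hn M a s).map (Complex.ofReal))⁻¹ *ᵥ
        (fun x : ↥(boxDom (dbl fun i => n * M i)) => chiT (dbl M) p (blk n x.1)) =
      fun x => resFieldR n (dbl fun i => n * M i) (dbl M) (mhatT (L := L) hn M s y₀ p) a p x.1 := by
  set A := (torLineRepA (L := L) hn M a s).map (Complex.ofReal) with hA
  set Φ : ↥(boxDom (dbl fun i => n * M i)) → ℂ :=
    fun x => resFieldR n (dbl fun i => n * M i) (dbl M) (mhatT (L := L) hn M s y₀ p) a p x.1 with hΦ
  have hAΦ : A *ᵥ Φ = fun x => chiT (dbl M) p (blk n x.1) := by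
    funext x
    rw [hA, map_mulVec_apply]
    exact line_resolvent_wave hn hM ha hs0 y₀ hp x
  rw [← hAΦ, Matrix.mulVec_mulVec, Matrix.nonsing_inv_mul _ (isUnit_det_torLineRepA_C (L := L) hn hM ha hs0 hs1),
    Matrix.one_mulVec]

/-- entrywise: `Σ_{x′} (A_ℂ⁻¹)(x, x′)·χ_p(blk_n x′) = Φ^R_p(x)`. [folklore] -/
theorem inv_mulVec_blockWave_apply (hn : 1 ≤ n) (hM : ∀ i, 1 ≤ M i) {a : ℝ} (ha : 0 < a) {s : ℝ} (hs0 : 0 ≤ s) (hs1 : s ≤ 1)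
    (y₀ : ↥(boxDom (dbl fun i => n * M i))) {p : Fin (d + 1) → ℤ} (hp : ∀ μ, 2 * |p μ| ≤ (dbl M μ : ℤ))
    (x : ↥(boxDom (dbl fun i => n * M i))) :
    ∑ x' : ↥(boxDom (dbl fun i => n * M i)), ((torLineRepA (L := L) hn M a s).map (Complex.ofReal))⁻¹ x x' *
        chiT (dbl M) p (blk n x'.1) =
      resFieldR n (dbl fun i => n * M i) (dbl M) (mhatT (L := L) hn M s y₀ p) a p x.1 := by
  have h := congrFun (inv_mulVec_blockWave (L := L) hn hM ha hs0 hs1 y₀ hp) x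
  simpa [Matrix.mulVec, dotProduct] using h

end Inverse

/-! ### §2 The resolvent kernel `(T^𝕋(s) + aQ_n^*Q_n)⁻¹Q_n^*` as a dual sum of the strip-engine multiplier over centred momenta -/

section Kernel

variable {n L : ℕ} [NeZero n] [NeZero L] {M : Fin (d + 1) → ℕ}

/-- the centred representative of a coarse dual index (file 61's `cRep` convention, on integer vectors): `p_μ` if `2p_μ < P_μ`,
else `p_μ − P_μ`. [folklore] -/
def cRepZ (P : Fin (d + 1) → ℕ) (p : Fin (d + 1) → ℤ) : Fin (d + 1) → ℤ :=
  p - fun μ => (P μ : ℤ) * (if 2 * p μ < (P μ : ℤ) then 0 else 1)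

omit [NeZero n] [NeZero L] in
/-- representatives in `boxDom P` have centred representatives: `2|cRepZ_μ| ≤ P_μ`. [folklore] -/
theorem two_abs_cRepZ_le {P : Fin (d + 1) → ℕ} {p : Fin (d + 1) → ℤ} (hp : p ∈ boxDom P) (μ : Fin (d + 1)) :
    2 * |cRepZ P p μ| ≤ (P μ : ℤ) := by
  have h := (mem_boxDom.1 hp) μ
  simp only [cRepZ, Pi.sub_apply]
  split_ifs with h2
  · rw [mul_zero, sub_zero, abs_of_nonneg h.1]; exact h2.le
  · rw [mul_one, abs_of_nonpos (by omega)]; omega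

omit [NeZero n] [NeZero L] in
/-- on the grid, `cRepZ` IS file 61's `cRep`. [folklore] -/
theorem cRepZ_grid (P : Fin (d + 1) → ℕ) (k : (i : Fin (d + 1)) → Fin (P i)) :
    cRepZ P (fun i => ((k i : ℕ) : ℤ)) = cRep P k := by
  funext μ
  simp only [cRepZ, cRep, Pi.sub_apply]
  by_cases h : 2 * (k μ : ℕ) < P μ
  · rw [if_pos h, if_pos (by exact_mod_cast h)]; ring
  · rw [if_neg h, if_neg (by exact_mod_cast h)]; ring

omit [NeZero n] [NeZero L] in
/-- characters do not see the centring. [folklore] -/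
theorem chiT_cRepZ {P : Fin (d + 1) → ℕ} (hP : ∀ i, 1 ≤ P i) (p y : Fin (d + 1) → ℤ) : chiT P (cRepZ P p) y = chiT P p y :=
  chiT_sub_period_left hP p _ y

omit [NeZero n] [NeZero L] in
/-- `χ_p(y)·χ_p(−β) = χ_p(y − β)`. [folklore] -/
theorem chiT_mul_chiT_neg (P : Fin (d + 1) → ℕ) (p y β : Fin (d + 1) → ℤ) :
    chiT P p y * chiT P p (-β) = chiT P p (y - β) := by
  rw [sub_eq_add_neg, chiT_add]

omit [NeZero n] [NeZero L] in
/-- block labels of fine representatives are coarse representatives. [folklore] -/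
theorem blk_mem_dbl (hn : 1 ≤ n) (x : ↥(boxDom (dbl fun i => n * M i))) : blk n x.1 ∈ boxDom (dbl M) := by
  rw [← image_blk_dbl hn M]
  exact Finset.mem_image_of_mem _ x.2

omit [NeZero n] [NeZero L] in
/-- **THE BLOCK INDICATOR AS A DUAL SUM**: `1[blk_n x′ = β] = |𝕋_c|⁻¹·Σ_{p ∈ 𝕋̂_c} χ_p(blk_n x′)·χ_p(−β)` for `β ∈ boxDom (2M)`. [folklore] -/
theorem blockIndicator_eq_dualSum (hn : 1 ≤ n) (hM : ∀ i, 1 ≤ M i) (x' : ↥(boxDom (dbl fun i => n * M i)))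
    {β : Fin (d + 1) → ℤ} (hβ : β ∈ boxDom (dbl M)) :
    (if blk n x'.1 = β then (1 : ℂ) else 0) =
      (((boxDom (dbl M)).card : ℂ))⁻¹ * ∑ p ∈ boxDom (dbl M), chiT (dbl M) p (blk n x'.1) * chiT (dbl M) p (-β) := by
  have hPc : ∀ i, 1 ≤ dbl M i := dbl_pos hM
  have hc : ((boxDom (dbl M)).card : ℂ) ≠ 0 := by
    have : 0 < (boxDom (dbl M)).card := Finset.card_pos.2 ⟨wrap (dbl M) 0, wrap_mem_boxDom hPc 0⟩
    exact_mod_cast this.ne'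
  simp_rw [chiT_mul_chiT_neg]
  rw [sum_chiT_dual hPc]
  have hiff : (∀ μ, (dbl M μ : ℤ) ∣ (blk n x'.1 - β) μ) ↔ blk n x'.1 = β := by
    rw [dvd_sub_iff_eq_wrap (blk_mem_dbl hn x') β, wrap_eq_self hβ]
  by_cases h : blk n x'.1 = β
  · rw [if_pos h, if_pos (hiff.mpr h), inv_mul_cancel₀ hc]
  · rw [if_neg h, if_neg (fun hd => h (hiff.mp hd)), mul_zero]

/-- **THE RESOLVENT KERNEL OF THE TWO-CUTOFF LINE AS A DUAL SUM OF THE STRIP MULTIPLIER**: for `a > 0`, `0 ≤ s ≤ 1`, mesh `n ≥ 1`,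
`L ≥ 1`, torus `M`, a fine representative `x = n·x⁰ + τ` and a coarse representative `β ∈ boxDom (2M)`,
`Σ_{x′} ((T^𝕋(s) + aQ_n^*Q_n)_ℂ⁻¹)(x, x′)·1[blk_n x′ = β] = |𝕋̂_c|⁻¹·Σ_{p ∈ boxDom (2M)} χ_{c(p)}(x⁰ − β)·GS n (lineSymb L n s) a τ (θ(c(p)))`
with `c(p) = cRepZ (2M) p` the centred representative — the kernel of `(T^𝕋(s) + aQ_n^*Q_n)⁻¹Q_n^*` IS the discrete-torus Fourier sum of
the strip engine's multiplier for the line (files 62–67), sampled at centred momenta.  [folklore] -/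
theorem resolventKernel_eq_dualSum (hn : 1 ≤ n) (hM : ∀ i, 1 ≤ M i) {a : ℝ} (ha : 0 < a) {s : ℝ} (hs0 : 0 ≤ s) (hs1 : s ≤ 1)
    (y₀ : ↥(boxDom (dbl fun i => n * M i))) (x : ↥(boxDom (dbl fun i => n * M i))) {x₀ : Fin (d + 1) → ℤ}
    {τ : Fin (d + 1) → Fin n} (hx : x.1 = finePt n x₀ τ) {β : Fin (d + 1) → ℤ} (hβ : β ∈ boxDom (dbl M)) :
    ∑ x' : ↥(boxDom (dbl fun i => n * M i)), ((torLineRepA (L := L) hn M a s).map (Complex.ofReal))⁻¹ x x' *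
        (if blk n x'.1 = β then (1 : ℂ) else 0) =
      (((boxDom (dbl M)).card : ℂ))⁻¹ * ∑ p ∈ boxDom (dbl M),
        chiT (dbl M) (cRepZ (dbl M) p) (x₀ - β) * GS n (lineSymb L n s) a τ (ofRealVec (thetaOf (dbl M) (cRepZ (dbl M) p))) := by
  have hPc : ∀ i, 1 ≤ dbl M i := dbl_pos hM
  set Ainv := ((torLineRepA (L := L) hn M a s).map (Complex.ofReal))⁻¹ with hAinv
  -- expand the indicator and exchange the sums
  have e0 : ∀ x' : ↥(boxDom (dbl fun i => n * M i)), Ainv x x' * (if blk n x'.1 = β then (1 : ℂ) else 0) =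
      (((boxDom (dbl M)).card : ℂ))⁻¹ *
        ∑ p ∈ boxDom (dbl M), Ainv x x' * (chiT (dbl M) p (blk n x'.1) * chiT (dbl M) p (-β)) := by
    intro x'
    rw [blockIndicator_eq_dualSum hn hM x' hβ, Finset.mul_sum, Finset.mul_sum, Finset.mul_sum]
    exact Finset.sum_congr rfl (fun p _ => by ring)
  rw [Finset.sum_congr rfl (fun x' _ => e0 x'), ← Finset.mul_sum, Finset.sum_comm]
  congr 1
  refine Finset.sum_congr rfl (fun p hp => ?_)
  -- centre `p` inside the characters, pull `χ(−β)` out, apply the inverse to the block wave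
  have hcp : ∀ μ, 2 * |cRepZ (dbl M) p μ| ≤ (dbl M μ : ℤ) := two_abs_cRepZ_le hp
  have e1 : ∀ x' : ↥(boxDom (dbl fun i => n * M i)),
      Ainv x x' * (chiT (dbl M) p (blk n x'.1) * chiT (dbl M) p (-β)) =
        chiT (dbl M) (cRepZ (dbl M) p) (-β) * (Ainv x x' * chiT (dbl M) (cRepZ (dbl M) p) (blk n x'.1)) := by
    intro x'
    rw [← chiT_cRepZ hPc p (blk n x'.1), ← chiT_cRepZ hPc p (-β)]
    ring
  rw [Finset.sum_congr rfl (fun x' _ => e1 x'), ← Finset.mul_sum,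
    inv_mulVec_blockWave_apply (L := L) hn hM ha hs0 hs1 y₀ hcp x, hx,
    resFieldR_finePt (L := L) hn hM s y₀ hcp a x₀ τ, ← mul_assoc, mul_comm (chiT (dbl M) _ (-β)), chiT_mul_chiT_neg]

omit [NeZero n] [NeZero L] in
/-- characters do not see file 61's centring either. [folklore] -/
theorem chiT_cRepZ' {P : Fin (d + 1) → ℕ} (hP : ∀ i, 1 ≤ P i) (k : (i : Fin (d + 1)) → Fin (P i)) (y : Fin (d + 1) → ℤ) :
    chiT P (cRep P k) y = chiT P (fun i => ((k i : ℕ) : ℤ)) y := by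
  rw [← cRepZ_grid, chiT_cRepZ hP]

/-- **R-E1's OPERATOR-LEVEL TORUS DOCKING — THE KERNEL OF `(T^𝕋(s) + aQ_n^*Q_n)⁻¹Q_n^*` IS FILE 68's `torusKernelS` OF THE LINE**:
for `a > 0`, `0 ≤ s ≤ 1`, every mesh `n ≥ 1`, `L ≥ 1`, torus `M`, fine representative `x = n·x⁰ + τ` and coarse representative
`β ∈ boxDom (2M)`: `Σ_{x′} ((T^𝕋(s) + aQ_n^*Q_n)_ℂ⁻¹)(x, x′)·1[blk_n x′ = β] = torusKernelS n (lineSymb L n s) a τ (2M) (x⁰ − β)` — so every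
estimate files 62–71 proved for `torusKernelS n (lineSymb L n s) a τ` (`line_torusKernel_decay_torusMetric`, `line_dtorusKernel…`,
`line_htorusKernel…`, constants in `d, a±` (and `α`) only) is an estimate on the two-cutoff line's averaged resolvent `(T^𝕋(s) + aQ_n^*Q_n)⁻¹Q_n^*`
itself, for every `s ∈ [0,1]` (b04's `B4Torus248Decay` (ii) at `s = 0` included). [folklore] -/
theorem resolventKernel_eq_torusKernelS (hn : 1 ≤ n) (hM : ∀ i, 1 ≤ M i) {a : ℝ} (ha : 0 < a) {s : ℝ} (hs0 : 0 ≤ s) (hs1 : s ≤ 1)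
    (x : ↥(boxDom (dbl fun i => n * M i))) {x₀ : Fin (d + 1) → ℤ} {τ : Fin (d + 1) → Fin n} (hx : x.1 = finePt n x₀ τ)
    {β : Fin (d + 1) → ℤ} (hβ : β ∈ boxDom (dbl M)) :
    ∑ x' : ↥(boxDom (dbl fun i => n * M i)), ((torLineRepA (L := L) hn M a s).map (Complex.ofReal))⁻¹ x x' *
        (if blk n x'.1 = β then (1 : ℂ) else 0) =
      torusKernelS n (lineSymb L n s) a τ (dbl M) (x₀ - β) := by
  have hPc : ∀ i, 1 ≤ dbl M i := dbl_pos hM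
  rw [resolventKernel_eq_dualSum (L := L) hn hM ha hs0 hs1 x x hx hβ, torusKernelS, card_boxDom, sum_boxDom_eq_sum_grid]
  congr 1
  refine Finset.sum_congr rfl (fun k _ => ?_)
  have e : (ofRealVec fun i => 2 * Real.pi * rep (gridPt (dbl M) k i)) = ofRealVec (thetaOf (dbl M) (cRep (dbl M) k)) := by
    funext i; simp only [ofRealVec, rep_grid_eq hPc k i]
  rw [e, mFourier_gridPt_eq_chiT hPc, cRepZ_grid, chiT_cRepZ' hPc, mul_comm]

end Kernel

/-! ### §4 The same docking on the original index type (the `L`-block labels of the fine torus, as files 33–41 and 58–59 index the line) -/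

section Original

variable {n L : ℕ} [NeZero n] [NeZero L] {M : Fin (d + 1) → ℕ}

omit [NeZero n] in
/-- the complexified transported line is the reindexing of the complexified line. [folklore] -/
theorem torLineRepA_map_eq_reindex (hn : 1 ≤ n) (M : Fin (d + 1) → ℕ) (a s : ℝ) :
    (torLineRepA (L := L) hn M a s).map (Complex.ofReal) = Matrix.reindex (repEquiv n L M) (repEquiv n L M)
      ((torLine (isBlockUnion_fine (fineTor_isBlockUnion hn (NeZero.one_le : 1 ≤ L) M)) n a (fun i => n * L * M i)
        (fun i => n * M i) s).map (Complex.ofReal)) := by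
  ext x y
  rfl

omit [NeZero n] in
/-- entries of the inverse of the complexified line, read through the reindexing. [folklore] -/
theorem torLine_inv_apply (hn : 1 ≤ n) (M : Fin (d + 1) → ℕ) (a s : ℝ)
    (x y : ↥((boxDom (dbl fun i => n * L * M i)).image (blk L))) :
    ((torLine (isBlockUnion_fine (fineTor_isBlockUnion hn (NeZero.one_le : 1 ≤ L) M)) n a (fun i => n * L * M i)
        (fun i => n * M i) s).map (Complex.ofReal))⁻¹ x y =
      ((torLineRepA (L := L) hn M a s).map (Complex.ofReal))⁻¹ (repEquiv n L M x) (repEquiv n L M y) := by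
  rw [torLineRepA_map_eq_reindex, Matrix.inv_reindex]
  simp [Matrix.reindex_apply, Matrix.submatrix_apply]

/-- **THE DOCKING ON THE ORIGINAL INDEX TYPE**: for `a > 0`, `0 ≤ s ≤ 1`, `n, L ≥ 1`, torus `M`, an `L`-block label `x` of the fine torus with
`x = n·x⁰ + τ` and `β ∈ boxDom (2M)`:
`Σ_{x′} ((torLine(n,a,s))_ℂ⁻¹)(x, x′)·1[blk_n x′ = β] = torusKernelS n (lineSymb L n s) a τ (2M) (x⁰ − β)`. [folklore] -/
theorem torLine_resolventKernel_eq_torusKernelS (hn : 1 ≤ n) (hM : ∀ i, 1 ≤ M i) {a : ℝ} (ha : 0 < a) {s : ℝ} (hs0 : 0 ≤ s)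
    (hs1 : s ≤ 1) (x : ↥((boxDom (dbl fun i => n * L * M i)).image (blk L))) {x₀ : Fin (d + 1) → ℤ} {τ : Fin (d + 1) → Fin n}
    (hx : x.1 = finePt n x₀ τ) {β : Fin (d + 1) → ℤ} (hβ : β ∈ boxDom (dbl M)) :
    ∑ x' : ↥((boxDom (dbl fun i => n * L * M i)).image (blk L)),
        ((torLine (isBlockUnion_fine (fineTor_isBlockUnion hn (NeZero.one_le : 1 ≤ L) M)) n a (fun i => n * L * M i)
          (fun i => n * M i) s).map (Complex.ofReal))⁻¹ x x' * (if blk n x'.1 = β then (1 : ℂ) else 0) =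
      torusKernelS n (lineSymb L n s) a τ (dbl M) (x₀ - β) := by
  have hx' : (repEquiv n L M x).1 = finePt n x₀ τ := hx
  rw [← resolventKernel_eq_torusKernelS (L := L) hn hM ha hs0 hs1 (repEquiv n L M x) hx' hβ,
    ← Equiv.sum_comp (repEquiv n L M)]
  refine Finset.sum_congr rfl (fun x' _ => ?_)
  rw [torLine_inv_apply]
  rfl

end Original

end Summit.QuantumFields.BalabanUV.T4Continuum.NE7K1LinTorusResolventInverse

end
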